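import Literature.MathematicalPhysics.QuantumLattice.DuhamelTwoPoint
import HarnessLib

/-!
# Bogoliubov's inequality for a finite-dimensional quantum Gibbs state

For a Hermitian Hamiltonian `H : Matrix n n ℂ`, an inverse temperature `β ≥ 0` and the Gibbs state
`⟨X⟩ = tr(e^{-βH} X)/Z` (`Matrix.gibbsState β H`), **Bogoliubov's inequality** reads
`|⟨[C, A]⟩|² ≤ (β/2) ⟨{A, A†}⟩ ⟨[C†, [H, C]]⟩` for arbitrary `A`, `C`
(Bogoliubov 1962; Mermin–Wagner 1966; Gelfert–Nolting (2001) eq. (9); Mattis (2006) (7.224)).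
This file proves it in the form consumed by the Mermin–Wagner argument of
`HeisenbergOrder.lean`, namely for **Hermitian** `A` and `C`, where `½⟨{A, A†}⟩ = ⟨A²⟩` and
`[C†, [H, C]] = [C, [H, C]]`:

* `bogoliubov_inequality`:
  `‖⟨CA - AC⟩‖² ≤ β · Re ⟨A²⟩ · Re ⟨[C, [H, C]]⟩` (`Re ⟨A²⟩ = ⟨A²⟩` and
  `Re ⟨[C,[H,C]]⟩ = ⟨[C,[H,C]]⟩` are real anyway; the double commutator is written
  `C(HC - CH) - (HC - CH)C` as in `DuhamelTwoPoint.lean`).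

The proof is the textbook one (Mattis (2006) (7.226)–(7.231)), carried out directly on the pair
sums of `DuhamelTwoPoint.lean` in an eigenbasis of `H` (`A' = U⋆AU`, `wᵢ = e^{-βEᵢ}`):
`Z⟨CA - AC⟩ = Σᵢⱼ (wᵢ - wⱼ) C'ᵢⱼ conj(A'ᵢⱼ)` (`trace_gibbsWeight_mul_comm_sub`), the per-pair
inequality `(wᵢ - wⱼ)² ≤ β · ½(wᵢ + wⱼ) · (Eⱼ - Eᵢ)(wᵢ - wⱼ)` — i.e. `tanh x ≤ x`, obtained here as
"logarithmic mean ≤ arithmetic mean" (`duhamelKernel_le_half_add_exp`) combined with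
`(wᵢ - wⱼ)² = β K (Eⱼ - Eᵢ)(wᵢ - wⱼ)` (`Matrix.sq_exp_sub_exp_eq`) — and the Cauchy–Schwarz
inequality over pairs; `Σᵢⱼ ‖A'ᵢⱼ‖² ½(wᵢ + wⱼ) = Z⟨A²⟩` and
`Σᵢⱼ ‖C'ᵢⱼ‖² (Eⱼ - Eᵢ)(wᵢ - wⱼ) = Z⟨[C,[H,C]]⟩` are `Matrix.IsHermitian.re_gibbsState_sq` and
`Matrix.IsHermitian.re_gibbsState_doubleComm`.

## References

* N. N. Bogoliubov, Phys. Abh. Sowjetunion 6 (1962) 1, 113, 229 (the inequality).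
* N. D. Mermin, H. Wagner, *Absence of ferromagnetism or antiferromagnetism in one- or
  two-dimensional isotropic Heisenberg models*, Phys. Rev. Lett. 17 (1966) 1133–1136 (the
  inequality and its use), [MerminWagnerPRL1966].
* A. Gelfert, W. Nolting, *The absence of finite-temperature phase transitions in low-dimensional
  many-body models: a survey and new results*, J. Phys. Condens. Matter 13 (2001) R505, §2.3,
  eq. (9) [GelfertNolting2001].
* D. C. Mattis, *The Theory of Magnetism Made Simple* (2006), §7.15, eqs. (7.224)–(7.231) (proof via
  the scalar product `(A,B) = Σᵢⱼ (i|A|j)* (i|B|j) (Wᵢ - Wⱼ)/(Eⱼ - Eᵢ)` and Schwarz's inequality)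
  [Mattis2006].

## Design notes

Everything is over `ℂ`, `[Fintype n] [DecidableEq n]`, using Mathlib's `Matrix.gibbsState`
vocabulary of `FinDimSpectrum.lean` and the spectral pair sums of `DuhamelTwoPoint.lean`; no new
definition is introduced.
-/

noncomputable section

open scoped Matrix.Norms.L2Operator ComplexOrder
open Finset MeasureTheory intervalIntegral Matrix

namespace Literature.MathematicalPhysics.QuantumLattice

variable {n : Type*} [Fintype n] [DecidableEq n]

/-! ### Logarithmic mean ≤ arithmetic mean -/

omit [Fintype n] [DecidableEq n] in
/-- `∫₀¹ (a + s (b - a)) ds = (a + b)/2`. [folklore] -/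
theorem integral_affine_unit_interval (a b : ℝ) :
    ∫ s in (0 : ℝ)..1, (a + s * (b - a)) = (a + b) / 2 := by
  have h1 : IntervalIntegrable (fun _ : ℝ => a) volume 0 1 := intervalIntegrable_const
  have h2 : IntervalIntegrable (fun s : ℝ => s * (b - a)) volume 0 1 :=
    (by fun_prop : Continuous fun s : ℝ => s * (b - a)).intervalIntegrable 0 1
  rw [intervalIntegral.integral_add h1 h2, intervalIntegral.integral_const,
    intervalIntegral.integral_mul_const, integral_id]
  simp only [sub_zero, one_pow, ne_eq, OfNat.ofNat_ne_zero, not_false_eq_true, zero_pow,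
    smul_eq_mul, one_mul]
  ring

/-- **The logarithmic mean is at most the arithmetic mean**: the Duhamel kernel
`K_β(x,y) = ∫₀¹ e^{-β(sy + (1-s)x)} ds` satisfies `K_β(x,y) ≤ ½(e^{-βx} + e^{-βy})` (convexity of
`exp`). Equivalently `(wᵢ - wⱼ)/(Eⱼ - Eᵢ) ≤ ½β(wᵢ + wⱼ)`, i.e. `tanh x ≤ x`.
[cite: Mattis2006, §7.15 eq. (7.227)] -/
theorem duhamelKernel_le_half_add_exp (β x y : ℝ) :
    duhamelKernel β x y ≤ (Real.exp (-(β * x)) + Real.exp (-(β * y))) / 2 := by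
  rw [duhamelKernel, ← integral_affine_unit_interval]
  refine intervalIntegral.integral_mono_on zero_le_one
    ((continuous_duhamelKernel_integrand β x y).intervalIntegrable _ _)
    (Continuous.intervalIntegrable (by fun_prop) _ _) fun s hs => ?_
  obtain ⟨hs0, hs1⟩ := hs
  have key : -(β * (s * y + (1 - s) * x)) = (1 - s) • (-(β * x)) + s • (-(β * y)) := by
    simp only [smul_eq_mul]; ring
  have hconv := convexOn_exp.2 (Set.mem_univ (-(β * x))) (Set.mem_univ (-(β * y)))
    (by linarith : (0 : ℝ) ≤ 1 - s) hs0 (by ring : (1 - s) + s = 1)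
  rw [key]
  refine hconv.trans (le_of_eq ?_)
  simp only [smul_eq_mul]
  ring

/-- **The per-pair Bogoliubov inequality**: with `a = e^{-βx}`, `b = e^{-βy}`, `β ≥ 0`,
`(a - b)² ≤ β · ½(a + b) · ((y - x)(a - b))` (`(a-b)² = βK(y-x)(a-b)` and `K ≤ ½(a+b)`).
[cite: Mattis2006, §7.15 eq. (7.227)] -/
theorem sq_exp_sub_exp_le_half_add_mul (β x y : ℝ) (hβ : 0 ≤ β) :
    (Real.exp (-(β * x)) - Real.exp (-(β * y))) ^ 2 ≤
      β * ((Real.exp (-(β * x)) + Real.exp (-(β * y))) / 2) *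
        ((y - x) * (Real.exp (-(β * x)) - Real.exp (-(β * y)))) := by
  rw [sq_exp_sub_exp_eq]
  have hc := sub_mul_exp_sub_exp_nonneg hβ x y
  have hK := duhamelKernel_le_half_add_exp β x y
  exact mul_le_mul_of_nonneg_right (mul_le_mul_of_nonneg_left hK hβ) hc

/-! ### Spectral form of `Z⟨[C, A]⟩` -/

section Spectral

variable {H : Matrix n n ℂ}

/-- **Spectral form of the commutator expectation**: for Hermitian `A` and any `C`,
`tr(e^{-βH} (CA - AC)) = Σᵢⱼ (wᵢ - wⱼ) C'ᵢⱼ conj(A'ᵢⱼ)` with `A' = U⋆AU`, `C' = U⋆CU`,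
`wᵢ = e^{-βEᵢ}` in an eigenbasis of `H` (the scalar product `(A, B)` of the textbook proof evaluated
at `B = [C†, H]`). [cite: Mattis2006, §7.15 eqs. (7.226), (7.230)] -/
theorem trace_gibbsWeight_mul_comm_sub (hH : H.IsHermitian) {A : Matrix n n ℂ}
    (hA : A.IsHermitian) (C : Matrix n n ℂ) (β : ℝ) :
    (gibbsWeight β H * (C * A - A * C)).trace =
      ∑ i, ∑ j, ((Real.exp (-(β * hH.eigenvalues i)) - Real.exp (-(β * hH.eigenvalues j)) : ℝ) :
          ℂ) *
        ((star (hH.eigenvectorUnitary : Matrix n n ℂ) * C *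
            (hH.eigenvectorUnitary : Matrix n n ℂ)) i j *
          star ((star (hH.eigenvectorUnitary : Matrix n n ℂ) * A *
            (hH.eigenvectorUnitary : Matrix n n ℂ)) i j)) := by
  set U := (hH.eigenvectorUnitary : Matrix n n ℂ) with hU
  have hUm : U ∈ unitary (Matrix n n ℂ) := hH.eigenvectorUnitary.prop
  set A' := star U * A * U with hA'
  set C' := star U * C * U with hC'
  set W : n → ℂ := fun i => (Real.exp (-(β * hH.eigenvalues i)) : ℂ) with hW
  have hsA : ∀ i j, star (A' i j) = A' j i := fun i j => by
    rw [hA']; exact star_apply_rotate hA i j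
  have hrot : star U * (C * A - A * C) * U = C' * A' - A' * C' := by
    rw [Matrix.mul_sub, Matrix.sub_mul, star_unitary_mul_mul_mul hUm,
      star_unitary_mul_mul_mul hUm]
  rw [hH.gibbsWeight_eq β, ← hU, trace_unitary_conj_mul, hrot, Matrix.mul_sub, trace_sub,
    show diagonal W * (C' * A') = diagonal W * C' * A' from (Matrix.mul_assoc _ _ _).symm,
    show diagonal W * (A' * C') = diagonal W * A' * C' from (Matrix.mul_assoc _ _ _).symm,
    trace_diagonal_mul_mul, trace_diagonal_mul_mul]
  have h2 : ∑ i, ∑ j, W i * A' i j * C' j i = ∑ i, ∑ j, W j * star (A' i j) * C' i j := by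
    rw [Finset.sum_comm]
    refine sum_congr rfl fun i _ => sum_congr rfl fun j _ => ?_
    rw [hsA i j]
  rw [h2, ← sum_sub_distrib]
  refine sum_congr rfl fun i _ => ?_
  rw [← sum_sub_distrib]
  refine sum_congr rfl fun j _ => ?_
  rw [← hsA i j, hW]
  push_cast
  ring

/-- **Bogoliubov's inequality** (Hermitian form). For Hermitian `H`, `A`, `C` and `β ≥ 0`,
`|⟨CA - AC⟩_β|² ≤ β · ⟨A²⟩_β · ⟨[C, [H, C]]⟩_β`, where `⟨·⟩_β` is the Gibbs state
`tr(e^{-βH} ·)/Z` and `[C,[H,C]] = C(HC - CH) - (HC - CH)C`. This is Bogoliubov's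
`|⟨[C, A]⟩|² ≤ ½β ⟨{A, A†}⟩ ⟨[C†, [H, C]]⟩` (Gelfert–Nolting (2001) eq. (9); Mattis (2006)
(7.224); the form used by Mermin–Wagner, PRL 17 (1966) 1133) specialised to `A = A†`, `C = C†`.
Proof: in an eigenbasis `Z⟨CA - AC⟩ = Σᵢⱼ (wᵢ - wⱼ) C'ᵢⱼ conj A'ᵢⱼ`, the per-pair bound
`(wᵢ - wⱼ)² ≤ β ½(wᵢ + wⱼ)(Eⱼ - Eᵢ)(wᵢ - wⱼ)` and Cauchy–Schwarz; `Σ ‖A'ᵢⱼ‖² ½(wᵢ + wⱼ) = Z⟨A²⟩`,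
`Σ ‖C'ᵢⱼ‖² (Eⱼ - Eᵢ)(wᵢ - wⱼ) = Z⟨[C,[H,C]]⟩`.
[cite: GelfertNolting2001, §2.3 eq. (9)] [cite: Mattis2006, §7.15 eqs. (7.224)–(7.231)]
[cite: MerminWagnerPRL1966, p. 1133 (Bogoliubov's inequality)] -/
theorem bogoliubov_inequality (hH : H.IsHermitian) {A C : Matrix n n ℂ} (hA : A.IsHermitian)
    (hC : C.IsHermitian) {β : ℝ} (hβ : 0 ≤ β) :
    ‖gibbsState β H (C * A - A * C)‖ ^ 2 ≤
      β * (gibbsState β H (A * A)).re *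
        (gibbsState β H (C * (H * C - C * H) - (H * C - C * H) * C)).re := by
  rcases isEmpty_or_nonempty n with hn | hn
  · have h0 : ∀ X : Matrix n n ℂ, gibbsState β H X = 0 := fun X => by
      rw [gibbsState_apply]
      simp [Matrix.trace]
    simp [h0]
  -- abbreviations
  set U := (hH.eigenvectorUnitary : Matrix n n ℂ) with hU
  set E := hH.eigenvalues with hE
  set W : n → ℝ := fun i => Real.exp (-(β * E i)) with hW
  set Zr : ℝ := ∑ i, W i with hZr
  set a : n → n → ℝ := fun i j => ‖(star U * A * U) i j‖ with ha
  set c' : n → n → ℝ := fun i j => ‖(star U * C * U) i j‖ with hc'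
  set c : n → n → ℝ := fun i j => (E j - E i) * (W i - W j) with hc
  have hZr0 : 0 < Zr := hH.sum_exp_pos β
  have hc0 : ∀ i j, 0 ≤ c i j := fun i j => sub_mul_exp_sub_exp_nonneg hβ (E i) (E j)
  have hasymm : ∀ i j, a i j = a j i := by
    intro i j
    simp only [ha]
    rw [← star_apply_rotate hA i j, norm_star]
  -- the left-hand side as a pair sum
  have hL : gibbsState β H (C * A - A * C) =
      (Zr : ℂ)⁻¹ * ∑ i, ∑ j, ((W i - W j : ℝ) : ℂ) *
        ((star U * C * U) i j * star ((star U * A * U) i j)) := by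
    rw [gibbsState_apply, hH.partitionFn_eq_ofReal, trace_gibbsWeight_mul_comm_sub hH hA C β]
  have hLn : ‖gibbsState β H (C * A - A * C)‖ ≤
      Zr⁻¹ * ∑ i, ∑ j, |W i - W j| * (c' i j * a i j) := by
    rw [hL, norm_mul, norm_inv, Complex.norm_real, Real.norm_eq_abs, abs_of_pos hZr0]
    refine mul_le_mul_of_nonneg_left ?_ (inv_nonneg.2 hZr0.le)
    refine (norm_sum_le _ _).trans (sum_le_sum fun i _ => ?_)
    refine (norm_sum_le _ _).trans (sum_le_sum fun j _ => ?_)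
    rw [norm_mul, norm_mul, norm_star, Complex.norm_real, Real.norm_eq_abs]
  -- the two right-hand factors as pair sums
  have hg : (gibbsState β H (A * A)).re = Zr⁻¹ * ∑ i, ∑ j, a i j ^ 2 * ((W i + W j) / 2) := by
    rw [hH.re_gibbsState_sq hA β]
    congr 1
    have hsw : ∑ i, ∑ j, a i j ^ 2 * W i = ∑ i, ∑ j, a i j ^ 2 * W j := by
      rw [Finset.sum_comm]
      exact sum_congr rfl fun i _ => sum_congr rfl fun j _ => by rw [hasymm j i]
    have h2 : ∑ i, ∑ j, a i j ^ 2 * ((W i + W j) / 2) =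
        (∑ i, ∑ j, a i j ^ 2 * W i + ∑ i, ∑ j, a i j ^ 2 * W j) / 2 := by
      rw [← sum_add_distrib, Finset.sum_div]
      refine sum_congr rfl fun i _ => ?_
      rw [← sum_add_distrib, Finset.sum_div]
      refine sum_congr rfl fun j _ => ?_
      ring
    rw [h2, ← hsw]
    ring
  have hcc : (gibbsState β H (C * (H * C - C * H) - (H * C - C * H) * C)).re =
      Zr⁻¹ * ∑ i, ∑ j, c' i j ^ 2 * c i j := by
    rw [hH.re_gibbsState_doubleComm hC β]
  -- per-pair bound and Cauchy–Schwarz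
  have hpair : ∀ i j, |W i - W j| * (c' i j * a i j) ≤
      Real.sqrt (β * (a i j ^ 2 * ((W i + W j) / 2))) * Real.sqrt (c' i j ^ 2 * c i j) := by
    intro i j
    have ha0 : 0 ≤ a i j := norm_nonneg _
    have hc'0 : 0 ≤ c' i j := norm_nonneg _
    rw [← Real.sqrt_mul (mul_nonneg hβ (mul_nonneg (sq_nonneg _) (by positivity))),
      show β * (a i j ^ 2 * ((W i + W j) / 2)) * (c' i j ^ 2 * c i j) =
        (c' i j * a i j) ^ 2 * (β * ((W i + W j) / 2) * c i j) by ring,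
      Real.sqrt_mul (sq_nonneg _), Real.sqrt_sq (mul_nonneg hc'0 ha0), mul_comm]
    refine mul_le_mul_of_nonneg_left ?_ (mul_nonneg hc'0 ha0)
    rw [← Real.sqrt_sq_eq_abs]
    exact Real.sqrt_le_sqrt (sq_exp_sub_exp_le_half_add_mul β (E i) (E j) hβ)
  have hsum : ∑ i, ∑ j, |W i - W j| * (c' i j * a i j) ≤
      Real.sqrt (∑ i, ∑ j, β * (a i j ^ 2 * ((W i + W j) / 2))) *
        Real.sqrt (∑ i, ∑ j, c' i j ^ 2 * c i j) := by
    calc ∑ i, ∑ j, |W i - W j| * (c' i j * a i j)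
        ≤ ∑ i, ∑ j, Real.sqrt (β * (a i j ^ 2 * ((W i + W j) / 2))) *
            Real.sqrt (c' i j ^ 2 * c i j) :=
          sum_le_sum fun i _ => sum_le_sum fun j _ => hpair i j
      _ ≤ _ := by
          have hCS := Real.sum_sqrt_mul_sqrt_le (univ : Finset (n × n))
            (f := fun p => β * (a p.1 p.2 ^ 2 * ((W p.1 + W p.2) / 2)))
            (g := fun p => c' p.1 p.2 ^ 2 * c p.1 p.2)
            (fun p => mul_nonneg hβ (mul_nonneg (sq_nonneg _)
              (by simp only [hW]; positivity)))
            (fun p => mul_nonneg (sq_nonneg _) (hc0 _ _))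
          simpa only [Fintype.sum_prod_type] using hCS
  -- assemble
  set G : ℝ := ∑ i, ∑ j, a i j ^ 2 * ((W i + W j) / 2) with hG
  set D : ℝ := ∑ i, ∑ j, c' i j ^ 2 * c i j with hD
  have hG0 : 0 ≤ G := sum_nonneg fun i _ => sum_nonneg fun j _ =>
    mul_nonneg (sq_nonneg _) (by simp only [hW]; positivity)
  have hD0 : 0 ≤ D := sum_nonneg fun i _ => sum_nonneg fun j _ =>
    mul_nonneg (sq_nonneg _) (hc0 _ _)
  have hβG : ∑ i, ∑ j, β * (a i j ^ 2 * ((W i + W j) / 2)) = β * G := by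
    rw [hG, mul_sum]
    refine sum_congr rfl fun i _ => ?_
    rw [mul_sum]
  rw [hβG] at hsum
  have hZinv : 0 ≤ Zr⁻¹ := inv_nonneg.2 hZr0.le
  have hn0 : 0 ≤ ‖gibbsState β H (C * A - A * C)‖ := norm_nonneg _
  have hbound : ‖gibbsState β H (C * A - A * C)‖ ≤
      Zr⁻¹ * (Real.sqrt (β * G) * Real.sqrt D) :=
    hLn.trans (mul_le_mul_of_nonneg_left hsum hZinv)
  rw [hg, hcc]
  calc ‖gibbsState β H (C * A - A * C)‖ ^ 2
      ≤ (Zr⁻¹ * (Real.sqrt (β * G) * Real.sqrt D)) ^ 2 := pow_le_pow_left₀ hn0 hbound 2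
    _ = β * (Zr⁻¹ * G) * (Zr⁻¹ * D) := by
        rw [mul_pow, mul_pow, Real.sq_sqrt (mul_nonneg hβ hG0), Real.sq_sqrt hD0]
        ring

end Spectral

end Literature.MathematicalPhysics.QuantumLattice
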